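import Summits.NavierStokesRegularity.NavierStokesRegularity.Theorems.ExtremiserTransienceNearExtremalTransienceExtremiserLiouvilleConstantSpeedSlideEnstrophyPlanar
import HarnessLib

/-!
# Crux `ExtremiserTransience.NearExtremalTransience` (stmt-NavierStokesRegularity-21883), line `extremiser_liouville`,
# stub K1b — THE PLANEWISE HESSIAN IDENTITY `∫w(x₂)|∇_h²f|² = ∫w(x₂)(Δ_h f)²` (record §16 (H), an IBP of R6a-int)

`--supports stmt-NavierStokesRegularity-21883` (helper).  Author: prover seat `ns-el-k1b` (g9).

Record §0/§3: «`Δ_hV_h` controls `∇_h²V_h` planewise».  For `f = V_j` and an axial weight `w(x₂)` the defect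
`(∂₀∂₁f)² − ∂₀²f·∂₁²f = −det ∇_h(∇_h f)` is the null Lagrangian of the planar field `U = (∂₀f, ∂₁f, 0)`, so
`integral_axialWeight_det_hgrad_eq_zero` (…SlideEnstrophyPlanar, p737286) applied to `U` kills it:
* `hgradField_eq_comp` : `U = A ∘ DV` for a fixed linear `A` with `‖A‖ ≤ 2`;
* `integral_axialWeight_hessian_defect_eq_zero` : `∫w(x₂)(∂₀(∂₀f)·∂₁(∂₁f) − ∂₁(∂₀f)·∂₀(∂₁f)) = 0` (`f = V_j`, `D¹V, D²V ∈ L²`,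
  `w ∈ C¹` bounded, `w = 0` off `[−T,T]`).
(The rearrangement into `∫w|∇_h²f|² = ∫w(Δ_hf)²` is then pointwise algebra plus symmetry of mixed partials; CAS-certified, record §16 (H).)

WHAT THIS IS NOT: K1b is NOT proved; nothing here proves NS regularity. [folklore]
-/

noncomputable section

open Set Filter Topology MeasureTheory Metric Function InnerProductSpace
open scoped ENNReal NNReal Topology InnerProductSpace RealInnerProductSpace ContDiff
open Literature.Analysis.FluidPDE Literature.Analysis

namespace Summit.NavierStokesRegularity.NavierStokesRegularity.Theorems

-- the problem directory repeats the summit name (`NavierStokesRegularity/NavierStokesRegularity`)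
set_option linter.dupNamespace false

namespace ExtremiserLiouville

open DepletionLadder.KStar

variable {V : EuclideanSpace ℝ (Fin 3) → EuclideanSpace ℝ (Fin 3)} {w : ℝ → ℝ}

/-- The planar gradient field `U = (∂₀V_j, ∂₁V_j, 0)` is `A ∘ DV` for the linear map
`A(T) = (T e₀)_j e₀ + (T e₁)_j e₁`. [folklore] -/
theorem hgradField_eq_comp (V : EuclideanSpace ℝ (Fin 3) → EuclideanSpace ℝ (Fin 3)) (j : Fin 3) :
    (fun y : EuclideanSpace ℝ (Fin 3) =>
        (fderiv ℝ V y (EuclideanSpace.single (0 : Fin 3) (1 : ℝ)) j) • EuclideanSpace.single (0 : Fin 3) (1 : ℝ) +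
          (fderiv ℝ V y (EuclideanSpace.single (1 : Fin 3) (1 : ℝ)) j) • EuclideanSpace.single (1 : Fin 3) (1 : ℝ)) =
      ⇑(((EuclideanSpace.proj j : EuclideanSpace ℝ (Fin 3) →L[ℝ] ℝ).comp (ContinuousLinearMap.apply ℝ (EuclideanSpace ℝ (Fin 3)) (EuclideanSpace.single (0 : Fin 3) (1 : ℝ)))).smulRight (EuclideanSpace.single (0 : Fin 3) (1 : ℝ)) +
        ((EuclideanSpace.proj j : EuclideanSpace ℝ (Fin 3) →L[ℝ] ℝ).comp (ContinuousLinearMap.apply ℝ (EuclideanSpace ℝ (Fin 3)) (EuclideanSpace.single (1 : Fin 3) (1 : ℝ)))).smulRight (EuclideanSpace.single (1 : Fin 3) (1 : ℝ))) ∘ fderiv ℝ V := by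
  funext y
  simp [ContinuousLinearMap.smulRight_apply]

/-- `‖A‖ ≤ 2` for the map of `hgradField_eq_comp`. [folklore] -/
theorem norm_hgradCLM_le (j : Fin 3) :
    ‖((EuclideanSpace.proj j : EuclideanSpace ℝ (Fin 3) →L[ℝ] ℝ).comp (ContinuousLinearMap.apply ℝ (EuclideanSpace ℝ (Fin 3)) (EuclideanSpace.single (0 : Fin 3) (1 : ℝ)))).smulRight (EuclideanSpace.single (0 : Fin 3) (1 : ℝ)) +
        ((EuclideanSpace.proj j : EuclideanSpace ℝ (Fin 3) →L[ℝ] ℝ).comp (ContinuousLinearMap.apply ℝ (EuclideanSpace ℝ (Fin 3)) (EuclideanSpace.single (1 : Fin 3) (1 : ℝ)))).smulRight (EuclideanSpace.single (1 : Fin 3) (1 : ℝ))‖ ≤ 2 := by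
  refine ContinuousLinearMap.opNorm_le_bound _ zero_le_two fun T => ?_
  have n0 : ‖EuclideanSpace.single (0 : Fin 3) (1 : ℝ)‖ = 1 := by rw [PiLp.norm_single, norm_one]
  have n1 : ‖EuclideanSpace.single (1 : Fin 3) (1 : ℝ)‖ = 1 := by rw [PiLp.norm_single, norm_one]
  have b0 : |T (EuclideanSpace.single (0 : Fin 3) (1 : ℝ)) j| ≤ ‖T‖ :=
    (abs_apply_le_norm _ j).trans ((T.le_opNorm _).trans (by rw [n0, mul_one]))
  have b1 : |T (EuclideanSpace.single (1 : Fin 3) (1 : ℝ)) j| ≤ ‖T‖ :=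
    (abs_apply_le_norm _ j).trans ((T.le_opNorm _).trans (by rw [n1, mul_one]))
  simp only [add_apply, ContinuousLinearMap.smulRight_apply, ContinuousLinearMap.comp_apply, ContinuousLinearMap.apply_apply]
  refine (norm_add_le _ _).trans ?_
  rw [norm_smul, norm_smul, n0, n1, mul_one, mul_one, Real.norm_eq_abs, Real.norm_eq_abs]
  have : ((EuclideanSpace.proj j : EuclideanSpace ℝ (Fin 3) →L[ℝ] ℝ) (T (EuclideanSpace.single (0 : Fin 3) (1 : ℝ)))) =
      T (EuclideanSpace.single (0 : Fin 3) (1 : ℝ)) j := rfl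
  have h' : ((EuclideanSpace.proj j : EuclideanSpace ℝ (Fin 3) →L[ℝ] ℝ) (T (EuclideanSpace.single (1 : Fin 3) (1 : ℝ)))) =
      T (EuclideanSpace.single (1 : Fin 3) (1 : ℝ)) j := rfl
  rw [this, h']
  linarith

/-- **The planewise Hessian defect integrates to zero**: with `f = V_j`,
`∫w(x₂)(∂₀(∂₀f)·∂₁(∂₁f) − ∂₁(∂₀f)·∂₀(∂₁f)) = 0` (`D¹V, D²V ∈ L²`; `w ∈ C¹` bounded, `= 0` off `[−T, T]`). [folklore] -/
theorem integral_axialWeight_hessian_defect_eq_zero (hV : ContDiff ℝ ∞ V) (hw : ContDiff ℝ 1 w) {K T : ℝ}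
    (hwK : ∀ s, |w s| ≤ K) (hwT : ∀ s, T < |s| → w s = 0)
    (h1 : ∫⁻ x, ‖iteratedFDeriv ℝ 1 V x‖ₑ ^ 2 < ⊤) (h2 : ∫⁻ x, ‖iteratedFDeriv ℝ 2 V x‖ₑ ^ 2 < ⊤) (j : Fin 3) :
    (∫ x, w (x 2) *
        (fderiv ℝ (fun y => fderiv ℝ V y (EuclideanSpace.single (0 : Fin 3) (1 : ℝ)) j) x (EuclideanSpace.single (0 : Fin 3) (1 : ℝ)) *
            fderiv ℝ (fun y => fderiv ℝ V y (EuclideanSpace.single (1 : Fin 3) (1 : ℝ)) j) x (EuclideanSpace.single (1 : Fin 3) (1 : ℝ)) -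
          fderiv ℝ (fun y => fderiv ℝ V y (EuclideanSpace.single (0 : Fin 3) (1 : ℝ)) j) x (EuclideanSpace.single (1 : Fin 3) (1 : ℝ)) *
            fderiv ℝ (fun y => fderiv ℝ V y (EuclideanSpace.single (1 : Fin 3) (1 : ℝ)) j) x (EuclideanSpace.single (0 : Fin 3) (1 : ℝ)))) = 0 := by
  set e₀ : EuclideanSpace ℝ (Fin 3) := EuclideanSpace.single (0 : Fin 3) (1 : ℝ) with he₀
  set e₁ : EuclideanSpace ℝ (Fin 3) := EuclideanSpace.single (1 : Fin 3) (1 : ℝ) with he₁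
  set A := (((EuclideanSpace.proj j : EuclideanSpace ℝ (Fin 3) →L[ℝ] ℝ).comp (ContinuousLinearMap.apply ℝ (EuclideanSpace ℝ (Fin 3)) e₀)).smulRight e₀ +
        ((EuclideanSpace.proj j : EuclideanSpace ℝ (Fin 3) →L[ℝ] ℝ).comp (ContinuousLinearMap.apply ℝ (EuclideanSpace ℝ (Fin 3)) e₁)).smulRight e₁) with hA
  set U : EuclideanSpace ℝ (Fin 3) → EuclideanSpace ℝ (Fin 3) := fun y => (fderiv ℝ V y e₀ j) • e₀ + (fderiv ℝ V y e₁ j) • e₁ with hU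
  have hUA : U = ⇑A ∘ fderiv ℝ V := hgradField_eq_comp V j
  have hDV : ContDiff ℝ ∞ (fderiv ℝ V) := hV.fderiv_right (m := ∞) (by exact_mod_cast le_rfl)
  have hUs : ContDiff ℝ ∞ U := by rw [hUA]; exact A.contDiff.comp hDV
  have hA2 : ‖A‖ ≤ 2 := norm_hgradCLM_le j
  -- `D¹U ∈ L²`
  have hD2i : Integrable (fun x => ‖iteratedFDeriv ℝ 2 V x‖ ^ 2) (volume : Measure (EuclideanSpace ℝ (Fin 3))) :=
    integrable_sq_norm_of_lintegral (hV.continuous_iteratedFDeriv (WithTop.coe_le_coe.mpr le_top)) h2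
  have hU1 : ∫⁻ x, ‖iteratedFDeriv ℝ 1 U x‖ₑ ^ 2 < ⊤ := by
    refine lintegral_sq_lt_top_of_bound (hUs.continuous_iteratedFDeriv (WithTop.coe_le_coe.mpr le_top)) (hD2i.const_mul (2 ^ 2))
      fun x => ?_
    rw [hUA, ← mul_pow]
    refine pow_le_pow_left₀ (norm_nonneg _) ?_ 2
    refine (ContinuousLinearMap.norm_iteratedFDeriv_comp_left A hDV.contDiffAt (by exact_mod_cast le_top)).trans ?_
    rw [norm_iteratedFDeriv_fderiv]
    exact mul_le_mul_of_nonneg_right hA2 (norm_nonneg _)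
  -- `U ∈ L²` (globally), hence slab square integrable
  have hD1i : Integrable (fun x => ‖fderiv ℝ V x‖ ^ 2) (volume : Measure (EuclideanSpace ℝ (Fin 3))) := by
    have h := integrable_sq_norm_of_lintegral (hV.continuous_iteratedFDeriv (WithTop.coe_le_coe.mpr le_top)) h1
    refine h.congr (Eventually.of_forall fun x => ?_); dsimp only; rw [← norm_iteratedFDeriv_fderiv, norm_iteratedFDeriv_zero]
  have hUslab : Integrable (fun x => {x : EuclideanSpace ℝ (Fin 3) | |x 2| ≤ T}.indicator (fun x => ‖U x‖ ^ 2) x) volume := by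
    have hmeas : MeasurableSet {x : EuclideanSpace ℝ (Fin 3) | |x 2| ≤ T} :=
      (isClosed_le (continuous_abs.comp (PiLp.continuous_apply 2 _ (2 : Fin 3))) continuous_const).measurableSet
    refine ((hD1i.const_mul (2 ^ 2)).indicator hmeas).mono' ((hUs.continuous.norm.pow 2).aestronglyMeasurable.indicator hmeas)
      (Eventually.of_forall fun x => ?_)
    by_cases hx : x ∈ {x : EuclideanSpace ℝ (Fin 3) | |x 2| ≤ T}
    · rw [Set.indicator_of_mem hx, Set.indicator_of_mem hx, Real.norm_eq_abs, abs_of_nonneg (sq_nonneg _), ← mul_pow]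
      refine pow_le_pow_left₀ (norm_nonneg _) ?_ 2
      rw [hUA]; exact (A.le_opNorm _).trans (mul_le_mul_of_nonneg_right hA2 (norm_nonneg _))
    · rw [Set.indicator_of_notMem hx, Set.indicator_of_notMem hx, norm_zero]
  have key := integral_axialWeight_det_hgrad_eq_zero (V := U) hUs hw hwK hwT hU1 hUslab
  -- the components of `U`
  have hUd : Differentiable ℝ U := hUs.differentiable (by simp)
  have hU0 : (fun y => U y 0) = fun y => fderiv ℝ V y e₀ j := by funext y; simp [hU, he₀, he₁]
  have hU1' : (fun y => U y 1) = fun y => fderiv ℝ V y e₁ j := by funext y; simp [hU, he₀, he₁]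
  have c0 : ∀ x v, fderiv ℝ U x v 0 = fderiv ℝ (fun y => fderiv ℝ V y e₀ j) x v := fun x v => by
    rw [← fderiv_coord_apply (hUd x) 0 v, hU0]
  have c1 : ∀ x v, fderiv ℝ U x v 1 = fderiv ℝ (fun y => fderiv ℝ V y e₁ j) x v := fun x v => by
    rw [← fderiv_coord_apply (hUd x) 1 v, hU1']
  rw [← key]
  refine integral_congr_ae (Eventually.of_forall fun x => ?_)
  dsimp only
  rw [c0, c1, c0, c1]

end ExtremiserLiouville

end Summit.NavierStokesRegularity.NavierStokesRegularity.Theorems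

end
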